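import Literature.MathematicalPhysics.QuantumFieldTheory.Balaban1983to89.B3WT224Instance

/-!
# `Balaban1983to89.B3WTPropagator` — T. Bałaban, *(Higgs)₂,₃ quantum fields in a finite volume. III. Renormalization*,
# Commun. Math. Phys. **88** (1983) 411–445 [Balaban1983Higgs3], (2.25)/(2.26) p. 431: the propagator `C^η_{M²} = (−Δ^η+M²)⁻¹`
# of the Gaussian measure `dμ_{C^η_{M²}}` ON THE CONCRETE LATTICE MODEL (file 1/2; file 2/2 = `…B3WTCovariance`, the moments)

statement-level skeleton of published theorems with citation tags; proofs where landed; nothing here is a claim about the Yang–Mills mass gap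

Page 431 [PDF 21] (read as an image, `run/shared/lean/pub/pub-balaban/b2b-balaban-ref1/pages/1983-cmp88-higgs23-III/…-p021-x2.png`)
evaluates the Gaussian integrals `∫dμ_{C^η_{M²}}(φ)…` of the Ward–Takahashi identities (2.25)/(2.26) by their propagator, *"where
now the propagators are C^η_{M²}"*.  THIS FILE supplies, for the lattice model of `…B3WT223Instance` (fields `φ : T^{(j)} → R^N`,
Lebesgue `dφ`, weight `e^{−½⟨φ,(−Δ^η+M²)φ⟩}` = `B3WT223Instance.weight … 0`, `w = η^d`, `c = η⁻¹`):
* `sform`/`Ks` — the scalar form `⟨a,(−Δ^η+M²)a'⟩ = Σ_b η^d c²(a(b₊)−a(b₋))(a'(b₊)−a'(b₋)) + M²Σ_x η^d a(x)a'(x)` and its matrix,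
  positive definite for `η^d > 0`, `M² > 0` (`Ks_posDef`);
* `G` — **the propagator `C^η_{M²}(x,y)`** := `(Ks)⁻¹(x,y)`, the kernel of `(−Δ^η+M²)⁻¹` in the `η^d`-weighted convention
  (`Σ_y η^d C(x,y)((−Δ^η+M²)g)(y) = g(x)`: `Ks_mulVec_Gcol`), symmetric (`G_symm`);
* `Kbil` — the vector form `⟨φ,(−Δ^η+M²)ψ⟩` with `d/ds ⟨φ+sh,(−Δ^η+M²)(φ+sh)⟩ = 2⟨φ+sh,(−Δ^η+M²)h⟩` (`hasDerivAt_quadForm_transl`,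
  hence `hasDerivAt_weight_transl`) and `⟨φ,(−Δ^η+M²)(C(·,x)⊗v)⟩ = ⟪φ(x), v⟫` (`Kbil_gcol`);
* the bounds and continuity (`abs_Kbil_le`, `weight_transl_le`, `integrable_weight_mul`) feeding the Gaussian integration by parts
  of file 2/2.
(The scalar-carrier analogue on `ι → ℝ` is r06's `B9Eq3125Moment`; the present carrier is the product of Euclidean spaces
`T^{(j)} → R^N` of the (Higgs)₂,₃ model.)  Phase-2 RESERVE R11 (part 2b) of `PHASE2-TARGETS.md` §G.3; cell `lit-balaban`, seat p39
(gen 2, unit `lit-balaban-p39`), HOME `run/shared/lean/pub/lit-balaban/`.  Nothing beyond these lattice identities is asserted; no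
new `Prop` is introduced.
-/

noncomputable section

open scoped BigOperators InnerProductSpace

namespace Literature.MathematicalPhysics.QuantumFieldTheory.Balaban1983to89.B3WTPropagator

open _root_.MeasureTheory Matrix
open LatticeFieldCalculus B3WT223Instance B3WT224Instance

variable {P : Params} {j N : ℕ} (C : HiggsLattice.ChargeData N) (η w c M2 : ℝ)

/-! ## §1 The scalar form `⟨a,(−Δ^η+M²)a'⟩`, its matrix, and the propagator `C^η_{M²} = (−Δ^η+M²)⁻¹` -/

/-- `⟨a,(−Δ^η+M²)a'⟩ := Σ_b η^d c²(a(b₊)−a(b₋))(a'(b₊)−a'(b₋)) + M²Σ_x η^d a(x)a'(x)` on scalar lattice functions (the exponent of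
`dμ_{C^η_{M²}}` per field component). [cite: Balaban1983Higgs3, (2.25) p.431] -/
def sform (a a' : Site P j → ℝ) : ℝ :=
  (∑ b : PBond P j, w * (c ^ 2 * ((a b.tgt - a b.src) * (a' b.tgt - a' b.src)))) + M2 * ∑ x : Site P j, w * (a x * a' x)

/-- symmetry of the form. [cite: Balaban1983Higgs3, (2.25) p.431] -/
theorem sform_comm (a a' : Site P j → ℝ) : sform w c M2 a a' = sform w c M2 a' a := by
  unfold sform
  congr 1
  · exact Finset.sum_congr rfl fun b _ => by ring
  · congr 1
    exact Finset.sum_congr rfl fun x _ => by ring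

/-- additivity in the first slot. [cite: Balaban1983Higgs3, (2.25) p.431] -/
theorem sform_add_left (a₁ a₂ a' : Site P j → ℝ) :
    sform w c M2 (a₁ + a₂) a' = sform w c M2 a₁ a' + sform w c M2 a₂ a' := by
  unfold sform
  simp only [Pi.add_apply]
  rw [add_add_add_comm, ← Finset.sum_add_distrib, ← mul_add, ← Finset.sum_add_distrib]
  congr 1
  · exact Finset.sum_congr rfl fun b _ => by ring
  · congr 1
    exact Finset.sum_congr rfl fun x _ => by ring

/-- homogeneity in the first slot. [cite: Balaban1983Higgs3, (2.25) p.431] -/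
theorem sform_smul_left (r : ℝ) (a a' : Site P j → ℝ) : sform w c M2 (r • a) a' = r * sform w c M2 a a' := by
  unfold sform
  simp only [Pi.smul_apply, smul_eq_mul, Finset.mul_sum, mul_add]
  congr 1
  · exact Finset.sum_congr rfl fun b _ => by ring
  · exact Finset.sum_congr rfl fun x _ => by ring

/-- the form as a Mathlib bilinear form. [cite: Balaban1983Higgs3, (2.25) p.431] -/
def sbil : LinearMap.BilinForm ℝ (Site P j → ℝ) :=
  LinearMap.mk₂ ℝ (sform w c M2) (sform_add_left w c M2)
    (fun r a a' => by rw [smul_eq_mul]; exact sform_smul_left w c M2 r a a')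
    (fun a a₁ a₂ => by rw [sform_comm, sform_add_left, sform_comm w c M2 a₁, sform_comm w c M2 a₂])
    (fun r a a' => by rw [smul_eq_mul, sform_comm, sform_smul_left, sform_comm])

/-- unfolding. [cite: Balaban1983Higgs3, (2.25) p.431] -/
theorem sbil_apply (a a' : Site P j → ℝ) : sbil w c M2 a a' = sform w c M2 a a' := rfl

/-- the matrix `K = η^d(−Δ^η+M²)` of the scalar form (`⟨a,(−Δ^η+M²)a'⟩ = a·Ka'`). [cite: Balaban1983Higgs3, (2.25) p.431] -/
def Ks : Matrix (Site P j) (Site P j) ℝ := LinearMap.BilinForm.toMatrix' (sbil w c M2)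

/-- `⟨a,(−Δ^η+M²)a'⟩ = a·(Ka')`. [cite: Balaban1983Higgs3, (2.25) p.431] -/
theorem sform_eq_dotProduct (a a' : Site P j → ℝ) : sform w c M2 a a' = a ⬝ᵥ Ks w c M2 *ᵥ a' := by
  rw [← sbil_apply, Ks, ← Matrix.toBilin'_apply', Matrix.toBilin'_toMatrix']

/-- matrix entries. [cite: Balaban1983Higgs3, (2.25) p.431] -/
theorem Ks_apply (x y : Site P j) : Ks w c M2 x y = sform w c M2 (Pi.single x 1) (Pi.single y 1) :=
  LinearMap.BilinForm.toMatrix'_apply _ x y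

/-- `K` is symmetric. [cite: Balaban1983Higgs3, (2.25) p.431] -/
theorem Ks_symm (x y : Site P j) : Ks w c M2 x y = Ks w c M2 y x := by
  rw [Ks_apply, Ks_apply, sform_comm]

/-- `K` is Hermitian (real symmetric). [cite: Balaban1983Higgs3, (2.25) p.431] -/
theorem Ks_isHermitian : (Ks w c M2 : Matrix (Site P j) (Site P j) ℝ).IsHermitian :=
  Matrix.IsHermitian.ext fun x y => by rw [star_trivial, Ks_symm]

/-- **`K = η^d(−Δ^η+M²)` is positive definite** for `η^d > 0`, `M² > 0` (`⟨a,Ka⟩ ≥ M²Σ_xη^d a(x)²`). [cite: Balaban1983Higgs3, (2.25) p.431] -/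
theorem Ks_posDef (hw : 0 < w) (hM : 0 < M2) : (Ks w c M2 : Matrix (Site P j) (Site P j) ℝ).PosDef := by
  refine Matrix.PosDef.of_dotProduct_mulVec_pos (Ks_isHermitian w c M2) fun a ha => ?_
  rw [star_trivial, ← sform_eq_dotProduct]
  obtain ⟨x, hx⟩ := Function.ne_iff.mp ha
  unfold sform
  have h1 : 0 ≤ ∑ b : PBond P j, w * (c ^ 2 * ((a b.tgt - a b.src) * (a b.tgt - a b.src))) :=
    Finset.sum_nonneg fun b _ => mul_nonneg hw.le (mul_nonneg (sq_nonneg c) (mul_self_nonneg _))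
  have h2 : 0 < ∑ y : Site P j, w * (a y * a y) :=
    lt_of_lt_of_le (mul_pos hw (mul_self_pos.mpr hx))
      (Finset.single_le_sum (f := fun y => w * (a y * a y)) (fun y _ => mul_nonneg hw.le (mul_self_nonneg _))
        (Finset.mem_univ x))
  exact add_pos_of_nonneg_of_pos h1 (mul_pos hM h2)

/-- **The propagator `C^η_{M²}(x,y) := K⁻¹(x,y)`** — the kernel of `(−Δ^η+M²)⁻¹` in the `η^d`-weighted convention of the paper
(`Σ_y η^d C^η_{M²}(x,y)((−Δ^η+M²)g)(y) = g(x)`), *"the propagators are C^η_{M²}"* p. 431. [cite: Balaban1983Higgs3, (2.26) p.431] -/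
def G : Matrix (Site P j) (Site P j) ℝ := (Ks w c M2)⁻¹

/-- `K·C = 1`. [cite: Balaban1983Higgs3, (2.26) p.431] -/
theorem Ks_mul_G (hw : 0 < w) (hM : 0 < M2) : Ks w c M2 * G w c M2 = (1 : Matrix (Site P j) (Site P j) ℝ) :=
  Matrix.mul_nonsing_inv _ ((Matrix.isUnit_iff_isUnit_det _).mp (Ks_posDef w c M2 hw hM).isUnit)

/-- `C^η_{M²}` is symmetric. [cite: Balaban1983Higgs3, (2.26) p.431] -/
theorem G_symm (x y : Site P j) : G w c M2 x y = G w c M2 y x := by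
  have hT : (Ks w c M2)ᵀ = (Ks w c M2 : Matrix (Site P j) (Site P j) ℝ) := Matrix.ext fun x y => Ks_symm w c M2 y x
  calc G w c M2 x y = ((Ks w c M2)⁻¹)ᵀ y x := rfl
    _ = ((Ks w c M2)ᵀ)⁻¹ y x := by rw [Matrix.transpose_nonsing_inv]
    _ = G w c M2 y x := by rw [hT]; rfl

/-- the column `C^η_{M²}(·,x)` solves `K C(·,x) = δ_x`. [cite: Balaban1983Higgs3, (2.26) p.431] -/
theorem Ks_mulVec_Gcol (hw : 0 < w) (hM : 0 < M2) (x : Site P j) :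
    Ks w c M2 *ᵥ (fun z => G w c M2 z x) = Pi.single x 1 := by
  funext y
  have h := congrFun (congrFun (Ks_mul_G w c M2 hw hM) y) x
  rw [Matrix.mul_apply, Matrix.one_apply] at h
  rw [Pi.single_apply, ← h]
  rfl

/-! ## §2 The vector form `⟨φ,(−Δ^η+M²)ψ⟩` and its derivative along translations -/

/-- `⟨φ,(−Δ^η+M²)ψ⟩ := Σ_b η^d ⟪(∂^ηφ)(b),(∂^ηψ)(b)⟫ + M²Σ_x η^d ⟪φ(x),ψ(x)⟫` — the polar form of `B3WT223Instance.quadForm` at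
`A = 0`. [cite: Balaban1983Higgs3, (2.25) p.431] -/
def Kbil (φ ψ : Cfg P j N) : ℝ :=
  (∑ b : PBond P j, w * ⟪grad c φ b, grad c ψ b⟫_ℝ) + M2 * ∑ x : Site P j, w * ⟪φ x, ψ x⟫_ℝ

/-- `∂^η` is linear: `∂(φ+sh) = ∂φ + s∂h`. [cite: Balaban1984PropagatorsI, (1.2) p.18] -/
theorem grad_add_smul (φ h : Cfg P j N) (s : ℝ) (b : PBond P j) :
    grad c (φ + s • h) b = grad c φ b + s • grad c h b := by
  simp only [grad, Pi.add_apply, Pi.smul_apply, smul_sub, smul_add, smul_smul, mul_comm c s]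
  abel

/-- `d/ds ∂(φ+sh)(b) = (∂h)(b)`. [cite: Balaban1983Higgs3, (2.26) p.431] -/
theorem hasDerivAt_grad_transl (φ h : Cfg P j N) (b : PBond P j) (s : ℝ) :
    HasDerivAt (fun s : ℝ => grad c (φ + s • h) b) (grad c h b) s := by
  have h1 : HasDerivAt (fun s : ℝ => grad c φ b + s • grad c h b) (grad c h b) s := by
    simpa using ((hasDerivAt_id s).smul_const (grad c h b)).const_add (grad c φ b)
  exact h1.congr_of_eventuallyEq (Filter.Eventually.of_forall fun s => grad_add_smul c φ h s b)

/-- `⟨ψ,(−Δ^η+M²)ψ⟩` at `A = 0`, unfolded (`D_0 = ∂`). [cite: Balaban1983Higgs3, (2.25) p.431] -/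
theorem quadForm_zero_eq (ψ : Cfg P j N) : quadForm C η w c M2 (0 : VecField P j ℝ) ψ =
    (∑ b : PBond P j, w * ‖grad c ψ b‖ ^ 2) + M2 * ∑ x : Site P j, w * ‖ψ x‖ ^ 2 := by
  unfold quadForm covLaplaceForm massForm
  have h0 : covDerivScalar c (C.Urep η) (0 : VecField P j ℝ) ψ = grad c ψ := covDerivScalar_Urep_zero C η c ψ
  rw [h0]

/-- **`d/ds ⟨φ+sh,(−Δ^η+M²)(φ+sh)⟩ = 2⟨φ+sh,(−Δ^η+M²)h⟩`.** [cite: Balaban1983Higgs3, (2.26) p.431] -/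
theorem hasDerivAt_quadForm_transl (φ h : Cfg P j N) (s : ℝ) :
    HasDerivAt (fun s : ℝ => quadForm C η w c M2 (0 : VecField P j ℝ) (φ + s • h)) (2 * Kbil w c M2 (φ + s • h) h) s := by
  simp only [quadForm_zero_eq, Pi.add_apply, Pi.smul_apply]
  have h1 : HasDerivAt (fun s : ℝ => ∑ b : PBond P j, w * ‖grad c (φ + s • h) b‖ ^ 2)
      (∑ b : PBond P j, w * (2 * ⟪grad c (φ + s • h) b, grad c h b⟫_ℝ)) s :=
    HasDerivAt.fun_sum fun b _ => (hasDerivAt_grad_transl c φ h b s).norm_sq.const_mul w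
  have h2 : HasDerivAt (fun s : ℝ => ∑ x : Site P j, w * ‖φ x + s • h x‖ ^ 2)
      (∑ x : Site P j, w * (2 * ⟪φ x + s • h x, h x⟫_ℝ)) s :=
    HasDerivAt.fun_sum fun x _ => by
      have hx : HasDerivAt (fun s : ℝ => φ x + s • h x) (h x) s := by
        simpa using ((hasDerivAt_id s).smul_const (h x)).const_add (φ x)
      exact hx.norm_sq.const_mul w
  refine (h1.add (h2.const_mul M2)).congr_deriv ?_
  unfold Kbil
  simp only [Pi.add_apply, Pi.smul_apply, Finset.mul_sum, mul_add]
  congr 1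
  · exact Finset.sum_congr rfl fun b _ => by ring
  · exact Finset.sum_congr rfl fun x _ => by ring

/-- `d/ds e^{−½⟨φ+sh,K(φ+sh)⟩} = −⟨φ+sh,Kh⟩·e^{−½⟨φ+sh,K(φ+sh)⟩}`. [cite: Balaban1983Higgs3, (2.26) p.431] -/
theorem hasDerivAt_weight_transl (φ h : Cfg P j N) (s : ℝ) :
    HasDerivAt (fun s : ℝ => weight C η w c M2 (0 : VecField P j ℝ) (φ + s • h))
      (-(Kbil w c M2 (φ + s • h) h) * weight C η w c M2 (0 : VecField P j ℝ) (φ + s • h)) s := by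
  unfold weight
  refine (((hasDerivAt_quadForm_transl C η w c M2 φ h s).const_mul (-(1 / 2 : ℝ))).exp).congr_deriv ?_
  ring

/-- `d/ds ⟪(φ+sh)(x), v⟫ = ⟪h(x), v⟫` (linear functionals along a translate). [cite: Balaban1983Higgs3, (2.26) p.431] -/
theorem hasDerivAt_inner_transl (φ h : Cfg P j N) (x : Site P j) (v : EuclideanSpace ℝ (Fin N)) (s : ℝ) :
    HasDerivAt (fun s : ℝ => ⟪(φ + s • h) x, v⟫_ℝ) ⟪h x, v⟫_ℝ s := by
  have h1 : HasDerivAt (fun s : ℝ => ⟪φ x, v⟫_ℝ + s * ⟪h x, v⟫_ℝ) ⟪h x, v⟫_ℝ s := by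
    simpa using ((hasDerivAt_id s).mul_const ⟪h x, v⟫_ℝ).const_add ⟪φ x, v⟫_ℝ
  refine h1.congr_of_eventuallyEq (Filter.Eventually.of_forall fun s => ?_)
  simp only [Pi.add_apply, Pi.smul_apply, inner_add_left, real_inner_smul_left]

/-- `∂(a⊗v)(b) = c(a(b₊)−a(b₋))·v` for a scalar profile `a` times a fixed vector `v`. [cite: Balaban1984PropagatorsI, (1.2) p.18] -/
theorem grad_smul_vec (a : Site P j → ℝ) (v : EuclideanSpace ℝ (Fin N)) (b : PBond P j) :
    grad c (fun z => a z • v) b = (c * (a b.tgt - a b.src)) • v := by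
  simp only [grad]
  rw [← sub_smul, smul_smul]

/-- `⟨φ,(−Δ^η+M²)(a⊗v)⟩ = ⟨(⟪φ(·),v⟫),(−Δ^η+M²)a⟩` (the vector form on a rank-one field is the scalar form). [cite: Balaban1983Higgs3, (2.26) p.431] -/
theorem Kbil_smul_vec (φ : Cfg P j N) (a : Site P j → ℝ) (v : EuclideanSpace ℝ (Fin N)) :
    Kbil w c M2 φ (fun z => a z • v) = sform w c M2 (fun z => ⟪φ z, v⟫_ℝ) a := by
  unfold Kbil sform
  congr 1
  · refine Finset.sum_congr rfl fun b _ => ?_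
    have hg : grad c φ b = c • (φ b.tgt - φ b.src) := rfl
    rw [grad_smul_vec, hg, real_inner_smul_left, real_inner_smul_right, inner_sub_left]
    ring
  · congr 1
    refine Finset.sum_congr rfl fun x _ => ?_
    rw [real_inner_smul_right]
    ring

/-- the field `C^η_{M²}(·,x) ⊗ v`. [cite: Balaban1983Higgs3, (2.26) p.431] -/
def gcol (x : Site P j) (v : EuclideanSpace ℝ (Fin N)) : Cfg P j N := fun z => G w c M2 z x • v

/-- **`⟨φ,(−Δ^η+M²)(C^η_{M²}(·,x)⊗v)⟩ = ⟪φ(x),v⟫`** (`(−Δ^η+M²)C^η_{M²} = δ`). [cite: Balaban1983Higgs3, (2.26) p.431] -/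
theorem Kbil_gcol (hw : 0 < w) (hM : 0 < M2) (φ : Cfg P j N) (x : Site P j) (v : EuclideanSpace ℝ (Fin N)) :
    Kbil w c M2 φ (gcol w c M2 x v) = ⟪φ x, v⟫_ℝ := by
  unfold gcol
  rw [Kbil_smul_vec, sform_eq_dotProduct, Ks_mulVec_Gcol w c M2 hw hM x, dotProduct_single, mul_one]

/-! ## §3 Bounds and continuity -/

/-- `|(∂^ηψ)(b)| ≤ 2|c|·sup|ψ|`. [cite: Balaban1984PropagatorsI, (1.2) p.18] -/
theorem norm_grad_le (ψ : Cfg P j N) (b : PBond P j) : ‖grad c ψ b‖ ≤ |c| * (2 * ‖ψ‖) := by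
  have hg : grad c ψ b = c • (ψ b.tgt - ψ b.src) := rfl
  rw [hg, norm_smul, Real.norm_eq_abs]
  refine mul_le_mul_of_nonneg_left ((norm_sub_le _ _).trans ?_) (abs_nonneg c)
  have := norm_le_pi_norm ψ b.tgt
  have := norm_le_pi_norm ψ b.src
  linarith

/-- the constant of `|⟨ψ,(−Δ^η+M²)h⟩| ≤ k(h)·sup|ψ|`. [cite: Balaban1983Higgs3, (2.26) p.431] -/
def kbound (h : Cfg P j N) : ℝ :=
  (∑ b : PBond P j, |w| * (|c| * 2 * ‖grad c h b‖)) + |M2| * ∑ x : Site P j, |w| * ‖h x‖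

/-- `k(h) ≥ 0`. [cite: Balaban1983Higgs3, (2.26) p.431] -/
theorem kbound_nonneg (h : Cfg P j N) : 0 ≤ kbound w c M2 h :=
  add_nonneg (Finset.sum_nonneg fun _ _ => by positivity) (mul_nonneg (abs_nonneg _) (Finset.sum_nonneg fun _ _ => by positivity))

/-- `|⟨ψ,(−Δ^η+M²)h⟩| ≤ k(h)·sup|ψ|`. [cite: Balaban1983Higgs3, (2.26) p.431] -/
theorem abs_Kbil_le (ψ h : Cfg P j N) : |Kbil w c M2 ψ h| ≤ kbound w c M2 h * ‖ψ‖ := by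
  unfold Kbil kbound
  rw [add_mul, Finset.sum_mul, mul_assoc, Finset.sum_mul]
  refine (abs_add_le _ _).trans (add_le_add ?_ ?_)
  · refine (Finset.abs_sum_le_sum_abs _ _).trans (Finset.sum_le_sum fun b _ => ?_)
    rw [abs_mul]
    calc |w| * |⟪grad c ψ b, grad c h b⟫_ℝ| ≤ |w| * (‖grad c ψ b‖ * ‖grad c h b‖) :=
          mul_le_mul_of_nonneg_left (abs_real_inner_le_norm _ _) (abs_nonneg w)
      _ ≤ |w| * (|c| * (2 * ‖ψ‖) * ‖grad c h b‖) :=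
          mul_le_mul_of_nonneg_left (mul_le_mul_of_nonneg_right (norm_grad_le c ψ b) (norm_nonneg _)) (abs_nonneg w)
      _ = |w| * (|c| * 2 * ‖grad c h b‖) * ‖ψ‖ := by ring
  · rw [abs_mul]
    refine mul_le_mul_of_nonneg_left ((Finset.abs_sum_le_sum_abs _ _).trans (Finset.sum_le_sum fun x _ => ?_)) (abs_nonneg M2)
    rw [abs_mul]
    calc |w| * |⟪ψ x, h x⟫_ℝ| ≤ |w| * (‖ψ x‖ * ‖h x‖) := mul_le_mul_of_nonneg_left (abs_real_inner_le_norm _ _) (abs_nonneg w)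
      _ ≤ |w| * (‖ψ‖ * ‖h x‖) :=
          mul_le_mul_of_nonneg_left (mul_le_mul_of_nonneg_right (norm_le_pi_norm ψ x) (norm_nonneg _)) (abs_nonneg w)
      _ = |w| * ‖h x‖ * ‖ψ‖ := by ring

/-- `φ ↦ (∂^ηφ)(b)` is continuous. [cite: Balaban1984PropagatorsI, (1.2) p.18] -/
theorem continuous_grad (b : PBond P j) : Continuous fun φ : Cfg P j N => grad c φ b :=
  ((continuous_apply b.tgt).sub (continuous_apply b.src)).const_smul c

/-- `φ ↦ ⟨φ,(−Δ^η+M²)h⟩` is continuous. [cite: Balaban1983Higgs3, (2.26) p.431] -/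
theorem continuous_Kbil_left (h : Cfg P j N) : Continuous fun φ : Cfg P j N => Kbil w c M2 φ h := by
  unfold Kbil
  refine (continuous_finsetSum _ fun b _ => continuous_const.mul ((continuous_grad c b).inner continuous_const)).add
    (continuous_const.mul (continuous_finsetSum _ fun x _ => continuous_const.mul ((continuous_apply x).inner continuous_const)))

/-- `½|u|² − |v|² ≤ |u+v|²`. [folklore] -/
private theorem half_sq_sub_le (u v : EuclideanSpace ℝ (Fin N)) : (1 / 2) * ‖u‖ ^ 2 - ‖v‖ ^ 2 ≤ ‖u + v‖ ^ 2 := by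
  have h1 : ‖u‖ ≤ ‖u + v‖ + ‖v‖ := by
    have := norm_sub_le (u + v) v
    rwa [add_sub_cancel_right] at this
  have h2 : ‖u‖ ^ 2 ≤ (‖u + v‖ + ‖v‖) ^ 2 := pow_le_pow_left₀ (norm_nonneg u) h1 2
  have h3 : (‖u + v‖ + ‖v‖) ^ 2 ≤ 2 * ‖u + v‖ ^ 2 + 2 * ‖v‖ ^ 2 := by
    nlinarith [sq_nonneg (‖u + v‖ - ‖v‖)]
  linarith

/-- the Gaussian weight along a translate, majorized uniformly for `|s| ≤ 1`:
`e^{−½⟨φ+sh,K(φ+sh)⟩} ≤ e^{aΣ_x|h(x)|²}·e^{−(a/2)Σ_x|φ(x)|²}`, `a = M²η^d/2`. [cite: Balaban1983Higgs3, (2.26) p.431] -/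
theorem weight_transl_le (hw : 0 ≤ w) (hM : 0 ≤ M2) (φ h : Cfg P j N) {s : ℝ} (hs : |s| ≤ 1) :
    weight C η w c M2 (0 : VecField P j ℝ) (φ + s • h) ≤
      Real.exp (M2 * w / 2 * ∑ x : Site P j, ‖h x‖ ^ 2) * Real.exp (-(M2 * w / 4) * ∑ x : Site P j, ‖φ x‖ ^ 2) := by
  refine (weight_le_gauss hw _ _).trans ?_
  rw [← Real.exp_add, Real.exp_le_exp, Finset.mul_sum, Finset.mul_sum, Finset.mul_sum, ← Finset.sum_add_distrib]
  refine Finset.sum_le_sum fun x _ => ?_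
  simp only [Pi.add_apply, Pi.smul_apply]
  have h1 := half_sq_sub_le (φ x) (s • h x)
  have h2 : ‖s • h x‖ ^ 2 ≤ ‖h x‖ ^ 2 := by
    rw [norm_smul, Real.norm_eq_abs]
    have : |s| * ‖h x‖ ≤ 1 * ‖h x‖ := mul_le_mul_of_nonneg_right hs (norm_nonneg _)
    rw [one_mul] at this
    exact pow_le_pow_left₀ (by positivity) this 2
  have ha : 0 ≤ M2 * w / 2 := by positivity
  nlinarith

/-- **integrability against the Gaussian**: `e^{−½⟨φ,Kφ⟩}g(φ)` is integrable for continuous `g` of exponential-linear growth.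
[cite: Balaban1983Higgs3, (2.26) p.431] -/
theorem integrable_weight_mul (hw : 0 < w) (hM : 0 < M2) {g : Cfg P j N → ℝ} (hgc : Continuous g) {K κ : ℝ}
    (hgb : ∀ φ, |g φ| ≤ K * Real.exp (κ * ‖φ‖)) :
    Integrable (fun φ => weight C η w c M2 (0 : VecField P j ℝ) φ * g φ) := by
  have ha : 0 < M2 * w / 2 := by positivity
  refine ((integrable_explin_mul_gauss (P := P) (j := j) (N := N) κ ha).const_mul K).mono'
    ((continuous_weight C η w c M2 _).mul hgc).aestronglyMeasurable (Filter.Eventually.of_forall fun φ => ?_)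
  rw [Real.norm_eq_abs, abs_mul, abs_of_pos (weight_pos (C := C) (η := η) (w := w) (c := c) (M2 := M2) _ φ)]
  calc weight C η w c M2 (0 : VecField P j ℝ) φ * |g φ|
      ≤ Real.exp (-(M2 * w / 2) * ∑ x : Site P j, ‖φ x‖ ^ 2) * (K * Real.exp (κ * ‖φ‖)) :=
        mul_le_mul (weight_le_gauss hw.le _ φ) (hgb φ) (abs_nonneg _) (Real.exp_pos _).le
    _ = K * (Real.exp (κ * ‖φ‖) * Real.exp (-(M2 * w / 2) * ∑ x : Site P j, ‖φ x‖ ^ 2)) := by ring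

end Literature.MathematicalPhysics.QuantumFieldTheory.Balaban1983to89.B3WTPropagator

end
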